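import Summits.AtomisticToContinuum.HydrodynamicLimit.Theorems.LambertianContactSwapSwapGapEntropyTransfer
import Summits.AtomisticToContinuum.HydrodynamicLimit.Theorems.JParityClosureParityInBandSmoothTest
import Literature.MathematicalPhysics.KineticTheory.LambertianRedrawNondegenerate
import Literature.Analysis.FluidPDE.HardSphereMomentumConservation
import HarnessLib

/-!
# `SwapGap` (stmt-AtomisticToContinuum-11850), line `Sketch`, stub T3: the crux is exact for constant test functions

Helper file of the line `Sketch` for the crux
`Summit.AtomisticToContinuum.HydrodynamicLimit.Theses.LambertianContactSwap.SwapGap`: the registered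
interface stub T3 `stub_swapGap_constTest` (conserved modes).  With `χ ≡ c` the `χ`-tested field triple
of a configuration `w` of `M` particles is `(M⁻¹ ∑ᵢ c, (M⁻¹ c) • ∑ᵢ vᵢ, M⁻¹ c · ½∑ᵢ‖vᵢ‖²)`
(`constTest_fieldTriple_eq`), a function of the total momentum `configMomentum w` and the kinetic
energy `configEnergy w` only.  Both are invariants of the deterministic hard-sphere flow `Φ_t` on its
good set (`HardSphereFlow.configMomentum_flow`, `IsHardSphereTrajectory.configEnergy_eq_holds`), which is
conull for the local Gibbs law `P_N ≪ liouville`, and of the Lambertian flow `Λ_t` for every datum and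
`γ^ℕ`-almost every noise (`configMomentum_lambertFlow`,
`ae_lambertNoise_forall_configEnergy_lambertFlow_hsDiameter`).  Hence for every measurable statistic `G`
of `(configMomentum, configEnergy)`, `∫ G ∘ Φ_t dP_N = ∫ G dP_N = ∫ G ∘ Λ_t d(P_N ⊗ γ^ℕ)`
(`constTest_integral_flow_eq_integral_lambertFlow`; `γ^ℕ` is a probability measure, `integral_fun_fst`),
and T3 is the instance `G = F ∘ fld(·, c)`.

prover-line-stmt-AtomisticToContinuum-11850-c5-0, cycle 6 (stub worker T3).
-/

noncomputable section

open MeasureTheory Filter Set Topology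
open scoped ENNReal

namespace Summit.AtomisticToContinuum.HydrodynamicLimit.Theorems

open Literature.Analysis.FluidPDE Literature.MathematicalPhysics.KineticTheory

/-! ### The field triple at a constant test function -/

/-- **The field triple at `χ ≡ c` in closed form**: for a configuration `w` of `M` particles,
`(ρ_c, m_c, e_c)(w) = (M⁻¹ ∑ᵢ c, (M⁻¹ c) • configMomentum w, M⁻¹ c · configEnergy w)` — a function of
the total momentum and the kinetic energy only (`integral_empiricalMeasure`, `integral_empiricalMeasure_vec`).
[folklore] -/
theorem constTest_fieldTriple_eq {M : ℕ} (w : Config M (Fin 3) T3) (c : ℝ) :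
    (empiricalDensityField w (fun _ => c), empiricalMomentumField w (fun _ => c),
        empiricalEnergyField w (fun _ => c)) =
      ((M : ℝ)⁻¹ * ∑ _i : Fin M, c, ((M : ℝ)⁻¹ * c) • configMomentum w,
        (M : ℝ)⁻¹ * c * configEnergy w) := by
  simp only [empiricalDensityField, empiricalMomentumField, empiricalEnergyField, Prod.mk.injEq]
  refine ⟨integral_empiricalMeasure w _, ?_, ?_⟩
  · rw [integral_empiricalMeasure_vec, configMomentum, ← Finset.smul_sum, smul_smul]
  · rw [integral_empiricalMeasure, configEnergy]
    have hsum : ∑ i, c * (‖(w i).2‖ ^ 2 / 2) = c * (2⁻¹ * ∑ i, ‖(w i).2‖ ^ 2) := by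
      rw [← mul_assoc, Finset.mul_sum]
      exact Finset.sum_congr rfl fun i _ => by ring
    rw [hsum]
    ring

/-- Configurations with the same total momentum and kinetic energy have the same `χ ≡ c` field
triple. [folklore] -/
theorem constTest_fieldTriple_congr {M : ℕ} {w w' : Config M (Fin 3) T3}
    (hp : configMomentum w = configMomentum w') (he : configEnergy w = configEnergy w') (c : ℝ) :
    (empiricalDensityField w (fun _ => c), empiricalMomentumField w (fun _ => c),
        empiricalEnergyField w (fun _ => c)) =
      (empiricalDensityField w' (fun _ => c), empiricalMomentumField w' (fun _ => c),
        empiricalEnergyField w' (fun _ => c)) := by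
  rw [constTest_fieldTriple_eq, constTest_fieldTriple_eq, hp, he]

/-! ### Statistics of the conserved modes have the same mean under `Φ_t` and `Λ_t` -/

/-- **Conserved statistics are swapped exactly.** For `0 ≤ σ < 1/2`, a hard-sphere flow `Φ` of `N + 1`
spheres of diameter `hsDiameter σ N` on `𝕋³`, a probability law `P` carried by the good set of `Φ`, a
measurable real statistic `G` of the configuration depending only on `(configMomentum, configEnergy)`,
and any time `t`: `∫ G(Φ_t z) dP = ∫ G(Λ_t(z, ξ)) d(P ⊗ γ^ℕ)`.  Both sides equal `∫ G dP`: `Φ_t`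
conserves momentum and energy on the good set (`HardSphereFlow.configMomentum_flow`,
`IsHardSphereTrajectory.configEnergy_eq_holds`), `Λ_t` conserves momentum everywhere
(`configMomentum_lambertFlow`) and energy for every datum and a.e. noise
(`ae_lambertNoise_forall_configEnergy_lambertFlow_hsDiameter`; Fubini through
`Measure.ae_prod_iff_ae_ae`, the statistic being jointly measurable by
`measurable_lambertFlow_hsDiameter`), and `γ^ℕ` has mass one (`integral_fun_fst`). [folklore] -/
theorem constTest_integral_flow_eq_integral_lambertFlow {σ : ℝ} (hσ : 0 ≤ σ) (hσ' : σ < 2⁻¹)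
    {N : ℕ} (Φ : HardSphereFlow (Torus.geometry (Fin 3)) (hsDiameter σ N) (N + 1))
    (P : Measure (Config (N + 1) (Fin 3) T3)) [IsProbabilityMeasure P] (hP : ∀ᵐ z ∂P, z ∈ Φ.good)
    {G : Config (N + 1) (Fin 3) T3 → ℝ} (hGm : Measurable G)
    (hG : ∀ w w' : Config (N + 1) (Fin 3) T3, configMomentum w = configMomentum w' →
      configEnergy w = configEnergy w' → G w = G w') (t : ℝ) :
    ∫ z, G (Φ.flow t z) ∂P =
      ∫ p, G (lambertFlow (Torus.geometry (Fin 3)) (hsDiameter σ N) p.2 p.1 t)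
        ∂(P.prod (lambertNoise (Fin 3))) := by
  -- `Φ` side: the statistic is invariant along good orbits, and `P`-a.e. datum is good
  have hΦ : ∫ z, G (Φ.flow t z) ∂P = ∫ z, G z ∂P := by
    refine integral_congr_ae ?_
    filter_upwards [hP] with z hz
    refine hG _ _ (Φ.configMomentum_flow hz t) ?_
    have h := IsHardSphereTrajectory.configEnergy_eq_holds (Φ.isTrajectory z hz) t 0
    simpa [Φ.flow_zero z hz] using h
  -- `Λ` side: momentum is conserved for every noise, energy for a.e. noise (every datum); Fubini
  have hΛm : Measurable fun p : Config (N + 1) (Fin 3) T3 × (ℕ → V3) =>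
      lambertFlow (Torus.geometry (Fin 3)) (hsDiameter σ N) p.2 p.1 t :=
    measurable_lambertFlow_hsDiameter hσ hσ' N t
  have hΛ : ∫ p, G (lambertFlow (Torus.geometry (Fin 3)) (hsDiameter σ N) p.2 p.1 t)
        ∂(P.prod (lambertNoise (Fin 3))) = ∫ p, G p.1 ∂(P.prod (lambertNoise (Fin 3))) := by
    refine integral_congr_ae ?_
    refine (Measure.ae_prod_iff_ae_ae ?_).2 (ae_of_all _ fun z =>
      (ae_lambertNoise_forall_configEnergy_lambertFlow_hsDiameter hσ hσ' N z).mono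
        fun ξs h => hG _ _ (configMomentum_lambertFlow ξs z t) (h t))
    exact measurableSet_eq_fun (hGm.comp hΛm) (hGm.comp measurable_fst)
  rw [hΦ, hΛ, integral_fun_fst, probReal_univ, one_smul]

/-! ### T3 -/

/-- **T3 · CONSERVED MODES: THE CRUX IS EXACT FOR CONSTANT TEST FUNCTIONS** (`stub_swapGap_constTest`):
for `0 < σ < 1/2`, continuous profiles, every `N`, every hard-sphere flow `Φ`, every `t ≥ 0`, every
constant `c` and every 1-Lipschitz `F` bounded by `1`, the two integrals of the crux COINCIDE: with
`χ ≡ c` the field triple is `(c, c·(N+1)⁻¹∑ᵢvᵢ, c·(N+1)⁻¹∑ᵢ‖vᵢ‖²/2)` (`constTest_fieldTriple_eq`), a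
function of the total momentum and kinetic energy, which `Φ_t` conserves on its good set
(`HardSphereFlow.configMomentum_flow`, `IsHardSphereTrajectory.configEnergy_eq_holds`; the good set is
`P_N`-conull since `P_N ≪ liouville`, `particleLaw_eq` + `withDensity_absolutelyContinuous`) and `Λ_t`
conserves `γ^ℕ`-almost surely (`configMomentum_lambertFlow`,
`ae_lambertNoise_forall_configEnergy_lambertFlow_hsDiameter`); so both integrands are a.e. the static
statistic `F(fld(z, c))`, and `γ^ℕ` is a probability measure
(`constTest_integral_flow_eq_integral_lambertFlow`).  `F` Lipschitz makes the statistic measurable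
(`measurable_fieldTriple`); the bound `|F| ≤ 1` and `t ≥ 0` are not needed. [folklore] -/
theorem stub_swapGap_constTest :
    ∀ σ : ℝ, 0 < σ → σ < 2⁻¹ → ∀ (a₀ θ₀ : T3 → ℝ) (u₀ : T3 → V3), Continuous a₀ → Continuous θ₀ → Continuous u₀ →
      (∀ x, 0 < a₀ x) → (∀ x, 0 < θ₀ x) →
      ∀ (N : ℕ) (Φ : HardSphereFlow (Torus.geometry (Fin 3)) (hsDiameter σ N) (N + 1)) (t : ℝ), 0 ≤ t →
        ∀ (c : ℝ) (F : ℝ × V3 × ℝ → ℝ), LipschitzWith 1 F → (∀ y, |F y| ≤ 1) →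
          ∫ z, F (empiricalDensityField (Φ.flow t z) (fun _ => c),
              empiricalMomentumField (Φ.flow t z) (fun _ => c),
              empiricalEnergyField (Φ.flow t z) (fun _ => c)) ∂(localGibbsLaw σ a₀ u₀ θ₀ N Φ) =
          ∫ p, F (empiricalDensityField
                (lambertFlow (Torus.geometry (Fin 3)) (hsDiameter σ N) p.2 p.1 t) (fun _ => c),
              empiricalMomentumField
                (lambertFlow (Torus.geometry (Fin 3)) (hsDiameter σ N) p.2 p.1 t) (fun _ => c),
              empiricalEnergyField
                (lambertFlow (Torus.geometry (Fin 3)) (hsDiameter σ N) p.2 p.1 t) (fun _ => c))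
            ∂((localGibbsLaw σ a₀ u₀ θ₀ N Φ).prod (lambertNoise (Fin 3))) := by
  intro σ hσ hσ' a₀ θ₀ u₀ ha hθ hu ha0 hθ0 N Φ t _ht c F hF _hF1
  haveI : IsProbabilityMeasure (localGibbsLaw σ a₀ u₀ θ₀ N Φ) :=
    isProbabilityMeasure_localGibbsLaw ha hθ hu ha0 hθ0 (by linarith) N Φ
  have hac : localGibbsLaw σ a₀ u₀ θ₀ N Φ ≪
      liouville (Torus.geometry (Fin 3)) (N + 1) (hsDiameter σ N) := by
    rw [localGibbsLaw, particleLaw_eq]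
    exact withDensity_absolutelyContinuous _ _
  exact constTest_integral_flow_eq_integral_lambertFlow hσ.le hσ' Φ (localGibbsLaw σ a₀ u₀ θ₀ N Φ)
    (hac.ae_le Φ.ae_mem_good)
    (G := fun w => F (empiricalDensityField w (fun _ => c), empiricalMomentumField w (fun _ => c),
      empiricalEnergyField w (fun _ => c)))
    (hF.continuous.measurable.comp (measurable_fieldTriple continuous_const))
    (fun w w' hp he => congrArg F (constTest_fieldTriple_congr hp he c)) t

end Summit.AtomisticToContinuum.HydrodynamicLimit.Theorems

end
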